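import Summits.HubbardSuperconductivity.HubbardSuperconductivity.Theses.CooperSharpness
import Summits.HubbardSuperconductivity.HubbardSuperconductivity.Theorems.CooperSharpnessTwistAveragingBoundModes
import Summits.HubbardSuperconductivity.HubbardSuperconductivity.Theorems.CooperSharpnessTwistAveragingBoundCost
import Summits.HubbardSuperconductivity.HubbardSuperconductivity.Theorems.BalabanIRBirEveryGroundStateSchur

/-!
# Route `CooperSharpness` — support item `TwistAveragingBound` (stmt-HubbardSuperconductivity-12854)

WHY THE LOCAL AXIS: a per-site mean-field pair penalty `(h/L²)·pFᴴ pF` raises the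
`(N, S^z = 0)`-sector ground energy of `hubbardTorus 2 L 1 U` by at most `C √h · L`
(universal `C`, all `U`, `h ∈ (0,1]`, `L ≥ L₀(h)`, every `N`).

Proof (twist averaging over a 2-D momentum window). For a unit vector `ψ` of the sector and
`k ∈ (ℤ/Lℤ)²` let `φ_k := T_k⁻¹ ψ` with `T_k = fockTwist (chargeTwist L k)` the spin-`↑`
charge twist of `Theorems/TwistGap…` (momentum `k`); `φ_k` is a unit vector of the same sector.
* Kinetic cost (Lieb–Schultz–Mattis): `⟨φ_k, H φ_k⟩ + ⟨φ_{-k}, H φ_{-k}⟩ = 2⟨ψ, H ψ⟩ + 2⟨ψ, P_θ ψ⟩`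
  (`fockTwist_conj_hamiltonianWith_add`; `T_{-k} = T_k⁻¹` because the twist angles agree
  mod `2π`), and `⟨ψ, P_θ ψ⟩ ≤ Σ_{u∼v} |cos Δθ - 1| ≤ 4L² · 2π²(a₀²+a₁²)/L²` for `k = (a₀, a₁)`
  (`re_expect_lsmPerturbation_le`, `sum_sum_adj_const_le`, `1 - cos x ≤ x²/2`).
* Pair weight (Parseval, Kennedy–Lieb–Shastry): `Σ_k ‖pF φ_k‖² = Σ_k ‖T_k pF T_k⁻¹ ψ‖² ≤ 50 L⁴`
  (`sum_eucNorm_twist_pairField_mulVec_sq_le`).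
* Average over the window `k = (a₀, a₁)`, `|aᵢ| ≤ M`, `2M + 1 ≤ L` (injective into `(ℤ/Lℤ)²`,
  `(2M+1)²` momenta, symmetric under `k ↦ -k`): some `φ_k` has
  `⟨φ_k, (H + c·pFᴴpF) φ_k⟩ ≤ ⟨ψ, H ψ⟩ + 16π²M² + 50 c L⁴/(2M+1)²`; with `c = h/L²` and
  `M = ⌈h^{1/4} √L / 2⌉` this is `≤ ⟨ψ, H ψ⟩ + (40π² + 50) √h L` once `L ≥ 16` and `√h L ≥ 1`.
* Variational principle in the sector (`le_csInf` over the Rayleigh set; an empty sector has the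
  same junk value `sInf ∅` on both sides).

Sources: E. Lieb, T. Schultz, D. Mattis, Ann. Phys. 16 (1961) 407, App. B; T. Koma, H. Tasaki,
PRL 68 (1992) 3248; T. Kennedy, E. Lieb, B. S. Shastry, PRL 61 (1988) 2582; T. A. Kaplan,
P. Horsch, W. von der Linden, J. Phys. Soc. Jpn. 58 (1989) 3894. No new definitions of record
(the momentum box and its embedding are proof-local abbreviations).
-/

-- the mandated namespace `Summit.<Summit>.<Problem>.Theorems` repeats `HubbardSuperconductivity`
-- (single-problem summit, D-0017), which the `dupNamespace` linter flags on every declaration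
set_option linter.dupNamespace false

noncomputable section

namespace Summit.HubbardSuperconductivity.HubbardSuperconductivity.Theorems.CooperSharpness

open Matrix Complex Finset Literature.MathematicalPhysics.QuantumLattice
  Literature.Probability.LatticeModels
open scoped ComplexConjugate ComplexOrder Matrix.Norms.L2Operator

/-! ### The momentum box and the averaging -/

section Window

variable {L : ℕ} [NeZero L]

/-- The box of integer momenta `{-M, …, M}²`. -/
abbrev intBox (M : ℕ) : Finset (ℤ × ℤ) := Finset.Icc (-(M : ℤ)) M ×ˢ Finset.Icc (-(M : ℤ)) M

omit [NeZero L] in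
/-- The box has `(2M+1)²` points. [folklore] -/
theorem card_intBox (M : ℕ) : (intBox M).card = (2 * M + 1) ^ 2 := by
  rw [Finset.card_product, Int.card_Icc]
  have : ((M : ℤ) + 1 - -(M : ℤ)).toNat = 2 * M + 1 := by omega
  rw [this]; ring

omit [NeZero L] in
/-- The box is symmetric under `p ↦ -p`. [folklore] -/
theorem neg_mem_intBox {M : ℕ} {p : ℤ × ℤ} (hp : p ∈ intBox M) : -p ∈ intBox M := by
  simp only [intBox, Finset.mem_product, Finset.mem_Icc, Prod.fst_neg, Prod.snd_neg] at hp ⊢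
  omega

omit [NeZero L] in
/-- Points of the box have `a₀² + a₁² ≤ 2M²`. [folklore] -/
theorem sq_add_sq_le_of_mem_intBox {M : ℕ} {p : ℤ × ℤ} (hp : p ∈ intBox M) :
    (p.1 : ℝ) ^ 2 + (p.2 : ℝ) ^ 2 ≤ 2 * (M : ℝ) ^ 2 := by
  simp only [intBox, Finset.mem_product, Finset.mem_Icc] at hp
  obtain ⟨⟨h1, h2⟩, h3, h4⟩ := hp
  have e1 : (p.1 : ℝ) ^ 2 ≤ (M : ℝ) ^ 2 := by
    have : |(p.1 : ℝ)| ≤ (M : ℝ) := by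
      rw [abs_le]; exact ⟨by exact_mod_cast h1, by exact_mod_cast h2⟩
    exact sq_le_sq' (abs_le.1 this).1 (abs_le.1 this).2
  have e2 : (p.2 : ℝ) ^ 2 ≤ (M : ℝ) ^ 2 := by
    have : |(p.2 : ℝ)| ≤ (M : ℝ) := by
      rw [abs_le]; exact ⟨by exact_mod_cast h3, by exact_mod_cast h4⟩
    exact sq_le_sq' (abs_le.1 this).1 (abs_le.1 this).2
  linarith

omit [NeZero L] in
/-- For `2M + 1 ≤ L` the box embeds into `(ℤ/Lℤ)²`. [folklore] -/
theorem kOfInt_injOn {M : ℕ} (hM : 2 * M + 1 ≤ L) : Set.InjOn (kOfInt L) (intBox M : Set (ℤ × ℤ)) := by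
  intro p hp q hq hpq
  simp only [Finset.coe_product, Finset.coe_Icc, Set.mem_prod, Set.mem_Icc] at hp hq
  have h0 := congrFun hpq 0
  have h1 := congrFun hpq 1
  simp only [kOfInt, Matrix.cons_val_zero, Matrix.cons_val_one] at h0 h1
  rw [ZMod.intCast_eq_intCast_iff_dvd_sub] at h0 h1
  have hb0 : |q.1 - p.1| < (L : ℤ) := by rw [abs_lt]; omega
  have hb1 : |q.2 - p.2| < (L : ℤ) := by rw [abs_lt]; omega
  have e0 := Int.eq_zero_of_abs_lt_dvd h0 hb0
  have e1 := Int.eq_zero_of_abs_lt_dvd h1 hb1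
  exact Prod.ext (by omega) (by omega)

/-- **Parseval over the box.** For `2M + 1 ≤ L` and every vector `ψ`, the pair weights of the
twisted trial states over the box sum to at most `50 L⁴ ‖ψ‖²`.
Kennedy–Lieb–Shastry, PRL 61 (1988) 2582. [folklore] -/
theorem sum_intBox_pairWeight_le {M : ℕ} (hM : 2 * M + 1 ≤ L) (ψ : Fock (Orb (FermionTorus 2 L))) :
    ∑ p ∈ intBox M, (star (fockTwist (-chargeTwist L (kOfInt L p)) *ᵥ ψ) ⬝ᵥ
        ((pairField dWaveFormFactor L)ᴴ * pairField dWaveFormFactor L) *ᵥ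
          (fockTwist (-chargeTwist L (kOfInt L p)) *ᵥ ψ)).re ≤
      50 * (L : ℝ) ^ 4 * eucNorm ψ ^ 2 := by
  simp only [re_expect_pairPenalty_twist_eq]
  rw [← Finset.sum_image (f := fun k : TorusSite 2 L => eucNorm ((fockTwist (chargeTwist L k) *
    pairField dWaveFormFactor L * fockTwist (-chargeTwist L k)) *ᵥ ψ) ^ 2) (kOfInt_injOn hM)]
  refine (Finset.sum_le_sum_of_subset_of_nonneg (Finset.subset_univ _) fun k _ _ => sq_nonneg _).trans
    ?_
  exact sum_eucNorm_twist_pairField_mulVec_sq_le abs_dWaveFormFactor_le_one ψ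

/-- **Kinetic average over the box** (the box is symmetric under `k ↦ -k`): for a unit `ψ`,
`Σ_{p ∈ box} re⟨φ_p, H φ_p⟩ ≤ |box| · (re⟨ψ, Hψ⟩ + 16π²M²)`. [folklore] -/
theorem sum_intBox_energy_le (U : ℝ) (M : ℕ) {ψ : Fock (Orb (FermionTorus 2 L))}
    (hψ : star ψ ⬝ᵥ ψ = 1) :
    ∑ p ∈ intBox M, (star (fockTwist (-chargeTwist L (kOfInt L p)) *ᵥ ψ) ⬝ᵥ
        hubbardTorus 2 L 1 U *ᵥ (fockTwist (-chargeTwist L (kOfInt L p)) *ᵥ ψ)).re ≤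
      (intBox M).card * ((star ψ ⬝ᵥ hubbardTorus 2 L 1 U *ᵥ ψ).re + 16 * Real.pi ^ 2 * (M : ℝ) ^ 2) := by
  set f : ℤ × ℤ → ℝ := fun p => (star (fockTwist (-chargeTwist L (kOfInt L p)) *ᵥ ψ) ⬝ᵥ
        hubbardTorus 2 L 1 U *ᵥ (fockTwist (-chargeTwist L (kOfInt L p)) *ᵥ ψ)).re with hf
  have hsymm : ∑ p ∈ intBox M, f p = ∑ p ∈ intBox M, f (-p) :=
    (Finset.sum_nbij' (fun p => -p) (fun p => -p) (fun p hp => neg_mem_intBox hp)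
      (fun p hp => neg_mem_intBox hp) (fun p _ => neg_neg p) (fun p _ => neg_neg p)
      (fun p _ => rfl)).symm
  have h2 : 2 * ∑ p ∈ intBox M, f p ≤
      ∑ p ∈ intBox M, (2 * (star ψ ⬝ᵥ hubbardTorus 2 L 1 U *ᵥ ψ).re + 16 * Real.pi ^ 2 * (2 * (M : ℝ) ^ 2)) := by
    rw [two_mul]
    nth_rewrite 2 [hsymm]
    rw [← Finset.sum_add_distrib]
    refine Finset.sum_le_sum fun p hp => ?_
    have h := re_energy_twist_pair_le U p hψ (L := L)
    have hb := sq_add_sq_le_of_mem_intBox hp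
    have : 16 * Real.pi ^ 2 * ((p.1 : ℝ) ^ 2 + (p.2 : ℝ) ^ 2) ≤ 16 * Real.pi ^ 2 * (2 * (M : ℝ) ^ 2) :=
      mul_le_mul_of_nonneg_left hb (by positivity)
    simp only [hf]
    linarith
  rw [Finset.sum_const, nsmul_eq_mul] at h2
  linarith

/-- **The twist-averaging bound at fixed window.** For `2M + 1 ≤ L`, `c ≥ 0` and every `N`:
`minEnergyOn (H + c·pFᴴpF) (N, 0) ≤ minEnergyOn H (N, 0) + 16π²M² + 50 c L⁴/(2M+1)²`.
Lieb–Schultz–Mattis twist average + Kennedy–Lieb–Shastry sum rule + the variational principle.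
[folklore] -/
theorem minEnergyOn_penalised_le_window (U : ℝ) {c : ℝ} (hc : 0 ≤ c) {M : ℕ} (hM : 2 * M + 1 ≤ L)
    (N : ℕ) :
    (hubbardTorus 2 L 1 U + (c : ℂ) •
        ((pairField dWaveFormFactor L)ᴴ * pairField dWaveFormFactor L)).minEnergyOn (szSector N 0) ≤
      (hubbardTorus 2 L 1 U).minEnergyOn (szSector N 0) + 16 * Real.pi ^ 2 * (M : ℝ) ^ 2 +
        50 * c * (L : ℝ) ^ 4 / (2 * M + 1) ^ 2 := by
  set H := hubbardTorus 2 L 1 U with hH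
  set P := (pairField dWaveFormFactor L)ᴴ * pairField dWaveFormFactor L with hP
  set K := szSector (Λ := FermionTorus 2 L) N 0 with hK
  set R : ℝ := 16 * Real.pi ^ 2 * (M : ℝ) ^ 2 + 50 * c * (L : ℝ) ^ 4 / (2 * M + 1) ^ 2 with hR
  have hR0 : 0 ≤ R := by positivity
  by_cases hne : ∃ ψ ∈ K, star ψ ⬝ᵥ ψ = 1
  · obtain ⟨ψ₀, hψ₀K, hψ₀⟩ := hne
    suffices h : (H + (c : ℂ) • P).minEnergyOn K - R ≤ H.minEnergyOn K by linarith
    refine le_csInf ⟨_, ψ₀, hψ₀K, hψ₀, rfl⟩ ?_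
    rintro E ⟨ψ, hψK, hψ, rfl⟩
    -- the trial family `φ_p = T_p⁻¹ ψ`, `p` in the box
    set φ : ℤ × ℤ → Fock (Orb (FermionTorus 2 L)) :=
      fun p => fockTwist (-chargeTwist L (kOfInt L p)) *ᵥ ψ with hφ
    have hφK : ∀ p, φ p ∈ K := fun p => fockTwist_mulVec_mem_szSector _ hψK
    have hφ1 : ∀ p, star (φ p) ⬝ᵥ φ p = 1 := fun p => by
      rw [hφ, star_fockTwist_mulVec_dotProduct, hψ]
    -- the averaged bound
    have hcard : ((intBox M).card : ℝ) = (2 * M + 1 : ℝ) ^ 2 := by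
      rw [card_intBox]; push_cast; ring
    have hcard_pos : (0 : ℝ) < (intBox M).card := by rw [hcard]; positivity
    have hbox : (intBox M).Nonempty := Finset.card_pos.1 (by exact_mod_cast hcard_pos)
    have he := sum_intBox_energy_le U M hψ (L := L)
    have hw := sum_intBox_pairWeight_le hM ψ
    rw [eucNorm_eq_one hψ, one_pow, mul_one] at hw
    have hw' : c * ∑ p ∈ intBox M, (star (φ p) ⬝ᵥ P *ᵥ φ p).re ≤ c * (50 * (L : ℝ) ^ 4) :=
      mul_le_mul_of_nonneg_left hw hc
    have hsplit : ∀ p, (star (φ p) ⬝ᵥ (H + (c : ℂ) • P) *ᵥ φ p).re =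
        (star (φ p) ⬝ᵥ H *ᵥ φ p).re + c * (star (φ p) ⬝ᵥ P *ᵥ φ p).re := by
      intro p
      rw [add_mulVec, dotProduct_add, Complex.add_re, smul_mulVec, dotProduct_smul, smul_eq_mul,
        Complex.re_ofReal_mul]
    have htot : ∑ p ∈ intBox M, (star (φ p) ⬝ᵥ (H + (c : ℂ) • P) *ᵥ φ p).re ≤
        (intBox M).card * ((star ψ ⬝ᵥ H *ᵥ ψ).re + 16 * Real.pi ^ 2 * (M : ℝ) ^ 2) +
          c * (50 * (L : ℝ) ^ 4) := by
      rw [Finset.sum_congr rfl fun p _ => hsplit p, Finset.sum_add_distrib, ← Finset.mul_sum]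
      exact add_le_add he hw'
    have hRdef : ((intBox M).card : ℝ) * ((star ψ ⬝ᵥ H *ᵥ ψ).re + R) =
        (intBox M).card * ((star ψ ⬝ᵥ H *ᵥ ψ).re + 16 * Real.pi ^ 2 * (M : ℝ) ^ 2) +
          c * (50 * (L : ℝ) ^ 4) := by
      have hsq : (2 * (M : ℝ) + 1) ^ 2 ≠ 0 := by positivity
      rw [hR, hcard]
      field_simp
      ring
    have hsum : ∑ p ∈ intBox M, (star (φ p) ⬝ᵥ (H + (c : ℂ) • P) *ᵥ φ p).re ≤
        ∑ _p ∈ intBox M, ((star ψ ⬝ᵥ H *ᵥ ψ).re + R) := by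
      rw [Finset.sum_const, nsmul_eq_mul, hRdef]
      exact htot
    obtain ⟨p, -, hp⟩ := Finset.exists_le_of_sum_le hbox hsum
    have hvar := minEnergyOn_le_re_rayleigh (H + (c : ℂ) • P) K (hφK p) (hφ1 p)
    linarith
  · -- no unit vector in the sector: both sides are the junk value `sInf ∅`
    have hempty : ∀ A : Matrix (Finset (Orb (FermionTorus 2 L))) (Finset (Orb (FermionTorus 2 L))) ℂ,
        {E : ℝ | ∃ ψ ∈ K, star ψ ⬝ᵥ ψ = 1 ∧ E = (star ψ ⬝ᵥ A *ᵥ ψ).re} = ∅ := by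
      intro A
      ext E
      simp only [Set.mem_setOf_eq, Set.mem_empty_iff_false, iff_false]
      rintro ⟨ψ, hψK, hψ, -⟩
      exact hne ⟨ψ, hψK, hψ⟩
    have h1 : (H + (c : ℂ) • P).minEnergyOn K = H.minEnergyOn K := by
      simp only [Matrix.minEnergyOn, hempty]
    rw [h1]
    linarith

end Window

/-! ### The item -/

section Main

/-- Arithmetic of the window choice: with `x = h^{1/4} √L / 2`, `M = ⌈x⌉₊`, `h ∈ (0,1]`,
`L ≥ 16` and `√h · L ≥ 1` one has `2M + 1 ≤ L` and
`16π²M² + 50 (h/L²) L⁴/(2M+1)² ≤ (40π² + 50) √h L`. [folklore] -/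
theorem window_arith {h : ℝ} {L : ℕ} (hh : 0 < h) (hh1 : h ≤ 1) (hL : 16 ≤ L)
    (hhL : 1 ≤ Real.sqrt h * L) :
    2 * ⌈Real.sqrt (Real.sqrt h) * Real.sqrt L / 2⌉₊ + 1 ≤ L ∧
      16 * Real.pi ^ 2 * (⌈Real.sqrt (Real.sqrt h) * Real.sqrt L / 2⌉₊ : ℝ) ^ 2 +
          50 * (h / (L : ℝ) ^ 2) * (L : ℝ) ^ 4 / (2 * ⌈Real.sqrt (Real.sqrt h) * Real.sqrt L / 2⌉₊ + 1) ^ 2 ≤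
        (40 * Real.pi ^ 2 + 50) * Real.sqrt h * L := by
  have hL0 : (0 : ℝ) < L := by exact_mod_cast (show 0 < L by omega)
  have hL16 : (16 : ℝ) ≤ L := by exact_mod_cast hL
  set s := Real.sqrt h with hs
  have hs0 : 0 < s := Real.sqrt_pos.2 hh
  have hs1 : s ≤ 1 := Real.sqrt_le_one.mpr hh1
  have hss : Real.sqrt s ^ 2 = s := Real.sq_sqrt hs0.le
  have hs2 : s ^ 2 = h := Real.sq_sqrt hh.le
  have hqL : Real.sqrt (L : ℝ) ^ 2 = L := Real.sq_sqrt hL0.le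
  have hq1 : Real.sqrt s ≤ 1 := Real.sqrt_le_one.mpr hs1  -- √s ≤ 1
  have hq0 : 0 ≤ Real.sqrt s := Real.sqrt_nonneg _
  have hsqL4 : Real.sqrt (L : ℝ) ≤ (L : ℝ) / 4 := by
    -- `√L ≤ L/4` iff `16 L ≤ L²` iff `16 ≤ L`
    rw [Real.sqrt_le_left (by positivity)]
    nlinarith
  set x := Real.sqrt s * Real.sqrt L / 2 with hx
  have hx0 : 0 ≤ x := by positivity
  set M := ⌈x⌉₊ with hM
  have hMx : x ≤ M := Nat.le_ceil x
  have hMx1 : (M : ℝ) < x + 1 := Nat.ceil_lt_add_one hx0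
  -- `x ≤ √L / 2 ≤ L/8`
  have hxL : x ≤ (L : ℝ) / 8 := by
    have : Real.sqrt s * Real.sqrt L ≤ 1 * Real.sqrt L :=
      mul_le_mul_of_nonneg_right hq1 (Real.sqrt_nonneg _)
    rw [hx]; linarith
  constructor
  · -- `2M + 1 ≤ L`
    have : (2 * M + 1 : ℝ) ≤ L := by linarith
    exact_mod_cast this
  · -- the bound
    have hden : Real.sqrt h * L ≤ (2 * (M : ℝ) + 1) ^ 2 := by
      have h2x : (2 * x) ^ 2 = s * L := by
        rw [hx]
        have : 2 * (Real.sqrt s * Real.sqrt ↑L / 2) = Real.sqrt s * Real.sqrt L := by ring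
        rw [this, mul_pow, hss, hqL]
      have : 2 * x ≤ 2 * (M : ℝ) + 1 := by linarith
      calc Real.sqrt h * L = (2 * x) ^ 2 := by rw [h2x]
        _ ≤ (2 * (M : ℝ) + 1) ^ 2 := pow_le_pow_left₀ (by positivity) this 2
    have hden_pos : (0 : ℝ) < (2 * (M : ℝ) + 1) ^ 2 := by positivity
    have hterm2 : 50 * (h / (L : ℝ) ^ 2) * (L : ℝ) ^ 4 / (2 * (M : ℝ) + 1) ^ 2 ≤ 50 * (Real.sqrt h * L) := by
      rw [div_le_iff₀ hden_pos]
      have hnum : 50 * (h / (L : ℝ) ^ 2) * (L : ℝ) ^ 4 = 50 * (Real.sqrt h * L) * (Real.sqrt h * L) := by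
        have : (Real.sqrt h * L) * (Real.sqrt h * L) = h * (L : ℝ) ^ 2 := by
          rw [← hs]; nlinarith [hs2]
        rw [mul_assoc 50 (Real.sqrt h * ↑L), this]
        field_simp
      rw [hnum]
      exact mul_le_mul_of_nonneg_left hden (by positivity)
    have hM2 : (M : ℝ) ^ 2 ≤ s * L / 2 + 2 := by
      have h1 : (M : ℝ) ^ 2 ≤ (x + 1) ^ 2 := pow_le_pow_left₀ (by positivity) hMx1.le 2
      have h2 : (x + 1) ^ 2 ≤ 2 * x ^ 2 + 2 := by nlinarith [sq_nonneg (x - 1)]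
      have h3 : x ^ 2 = s * L / 4 := by
        rw [hx, div_pow, mul_pow, hss, hqL]; ring
      nlinarith
    have hterm1 : 16 * Real.pi ^ 2 * (M : ℝ) ^ 2 ≤ 8 * Real.pi ^ 2 * (s * L) + 32 * Real.pi ^ 2 := by
      nlinarith [Real.pi_pos, sq_nonneg Real.pi]
    have hconst : 32 * Real.pi ^ 2 ≤ 32 * Real.pi ^ 2 * (s * L) := by
      rw [hs]; nlinarith [Real.pi_pos, sq_nonneg Real.pi]
    rw [hs] at hterm1 hconst
    nlinarith [hterm1, hterm2, hconst, Real.pi_pos]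

/-- **`TwistAveragingBound`** (stmt-HubbardSuperconductivity-12854): there is a universal `C`
(here `40π² + 50`) such that for all `U`, `h ∈ (0,1]`, `L ≥ L₀(h) := max 16 ⌈1/√h⌉₊` and every
sector `(N, S^z = 0)`,
`minEnergyOn (hubbardTorus 2 L 1 U + (h/L²)·pFᴴpF) ≤ minEnergyOn (hubbardTorus 2 L 1 U) + C √h L`:
average the twisted trial states `T_k⁻¹ψ` over the momentum box `|kᵢ| ≤ M = ⌈h^{1/4}√L/2⌉`
(kinetic cost `≤ 16π²M²` by Lieb–Schultz–Mattis, pair weight `≤ 50 h L²/(2M+1)²` by the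
Kennedy–Lieb–Shastry sum rule). Koma–Tasaki, PRL 68 (1992) 3248; Kaplan–Horsch–von der Linden,
J. Phys. Soc. Jpn. 58 (1989) 3894 (variational transfer). [folklore] -/
theorem twistAveragingBound_proof :
    Summit.HubbardSuperconductivity.HubbardSuperconductivity.Theses.CooperSharpness.TwistAveragingBound := by
  refine ⟨40 * Real.pi ^ 2 + 50, fun U h hh hh1 => ?_⟩
  refine ⟨max 16 ⌈1 / Real.sqrt h⌉₊, fun L _ hL N => ?_⟩
  have hL16 : 16 ≤ L := le_of_max_le_left hL
  have hLc : ⌈1 / Real.sqrt h⌉₊ ≤ L := le_of_max_le_right hL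
  have hs0 : 0 < Real.sqrt h := Real.sqrt_pos.2 hh
  have hhL : 1 ≤ Real.sqrt h * L := by
    have h1 : 1 / Real.sqrt h ≤ (L : ℝ) := (Nat.le_ceil _).trans (by exact_mod_cast hLc)
    rw [div_le_iff₀ hs0] at h1
    linarith
  obtain ⟨hM, hbound⟩ := window_arith hh hh1 hL16 hhL
  have hc : 0 ≤ h / (L : ℝ) ^ 2 := by positivity
  have key := minEnergyOn_penalised_le_window U hc hM N (L := L)
  push_cast at key hbound ⊢
  linarith

end Main

end Summit.HubbardSuperconductivity.HubbardSuperconductivity.Theorems.CooperSharpness
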